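import Summits.QuantumFields.BalabanUV.Beta.D1BFx.GhostCurrentRealised
import Summits.QuantumFields.BalabanUV.Beta.D1BFx.GhostHalfStencil

/-!
# `BalabanUV.Beta.D1BFx.GhostHalfRealised` — road «BF-x» for binder row D1, slot (K), RE-CUT END row **(K6a) tower part «MAINTABLE-HALF»**:
# the half word is a located-pair realisation, and its bubble over a frozen even leg is an3's «3+3» table `−F_{e_ν}g(v)·F_{e_μ}g(v+e_ν)`
# (K-END-RECUT-SPEC §5 (K5′)∕(K6a); letter annex an3-g46 HALFWORD-AUDIT v1 201e01c5073f7bcf item 4.1 (B4))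

HONEST FRAMING (cell contract, verbatim): «discharging `BetaPertH` makes Bałaban's UV stability UNCONDITIONAL — a real constructive-QFT
result; it is NOT the continuum limit and NOT the Clay problem.»  HONEST DEPENDENCY (verbatim): «continuum YM on T⁴ ⇐ BetaPertH ∧ nine
spine estimates (0/9 proved); BetaPertH ⇐ (D1) ∧ (D4) ∧ CAP+tail; G-an2-4 gates asym, D1 and NE2/3/4.»  THIS MODULE DISCHARGES NOTHING of
D1 / BetaPertH / the wall: [folklore] finite stencil algebra in the road's `realK` currency (`StencilRealisation`, `ModelTablesRealised`), the exact
analogue of `GhostCurrentRealised.bubble_ghCur_ghCur_frozen` (full current: `2·cellForm`) for the HALF word.  NOT D1, NOT BetaPertH, NOT continuum, NOT Clay.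

* §1 `halfStn κ m : Stn I := [⟨e_κ, 0, m⟩, ⟨e_κ, e_κ, −m⟩]` and `xhSt_eq_realK : xhSt κ u = realK u u (halfStn κ 1)`.
* §2 `bub_half_half` (an3's list combinator `GradedBubbles.bub` evaluated on two half lists) and
  **`bubble_xhSt_xhSt_frozen`**: for `g` even and the frozen leg `B x y a b = δ_{ab}·g(y − x)` on the ghost fibre `Unit`,
  `bubble B (xhSt μ u) (xhSt ν (u + (v + e_μ))) = −(g(v + e_ν) − g v)·(g(v + e_ν + e_μ) − g(v + e_ν))` — the four terms
  `g(v)g(v+e_μ+e_ν) − g(v+e_ν)g(v+e_μ+e_ν) − g(v)g(v+e_ν) + g(v+e_ν)²` of audit B4; NO `g·D_{μν}g` («2+4») part, unlike `cellForm`.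
Owner b2b-balaban-beta-d1-p2 (gen 7).  Nothing printed is used; 0 `def … : Prop`, nothing cited, 0 sorry.
-/

namespace Summit.QuantumFields.BalabanUV.Beta.D1BFx.GhostHalfRealised

open Finset
open scoped BigOperators
open Literature.MathematicalPhysics.QuantumFieldTheory.Balaban1983to89
open Literature.MathematicalPhysics.QuantumFieldTheory.Balaban1983to89.Beta
open ExpKernelCalculus (Site MKer bubble)
open DyadicShell (Pt)
open BubbleTransfer (unitVec)
open GradedBubbles (LP Stn Fam term bubRow bub)
open Summit.QuantumFields.BalabanUV.Beta.D1BFx.FiniteStencilCalculus (elemK elemK_apply)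
open Summit.QuantumFields.BalabanUV.Beta.D1BFx.StencilRealisation (realK realK_nil realK_cons bubble_realK_realK)
open Summit.QuantumFields.BalabanUV.Beta.D1BFx.ModelTablesRealised (trace_one_unit)
open Summit.QuantumFields.BalabanUV.Beta.D1BFx.GhostCurrentRealised (unitVec_affine_eq)
open Summit.QuantumFields.BalabanUV.Beta.D1BFx.GhostHalfStencil (xhSt xhSt_apply)

noncomputable section

variable {I : Type*} [Fintype I] [DecidableEq I]

/-! ## §1 The half word as a located-pair realisation -/

/-- [our object] **an3-STYLE LOCATED-PAIR LIST OF THE HALF WORD** with colour weight `m`: `halfStn κ m = [⟨e_κ, 0, m⟩, ⟨e_κ, e_κ, −m⟩]`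
(row offset, column offset, weight) — `E_tu − E_tt`.  A definition; asserts nothing. -/
def halfStn (κ : Fin 4) (m : Matrix I I ℝ) : Stn I := [⟨unitVec κ, 0, m⟩, ⟨unitVec κ, unitVec κ, -m⟩]

/-- [folklore] **`xhSt κ u = realK u u (halfStn κ 1)`** — the road's colour-stripped half word at the fine bond `(κ, u)` IS the kernel realisation, at the
base site `u`, of the two-pair list `halfStn κ 1`. -/
theorem xhSt_eq_realK (κ : Fin 4) (u : Pt) : xhSt κ u = realK u u (halfStn κ (1 : Matrix Unit Unit ℝ)) := by
  funext x z a b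
  rw [xhSt_apply, unitVec_affine_eq]
  simp only [halfStn, realK_cons, realK_nil, Pi.add_apply, elemK_apply, add_zero, Matrix.neg_apply, Matrix.one_apply_eq]
  split_ifs <;> norm_num

/-! ## §2 The half × half bubble over a frozen even leg -/

/-- [folklore] an3's list combinator on two half lists, at the relative position `w = v + e_μ` of the second base point:
`bub g g (halfStn μ 1) (halfStn ν 1) L k (v + e_μ) = g(v)g(v+e_μ+e_ν) − g(v+e_ν)g(v+e_μ+e_ν) − g(v)g(v+e_ν) + g(v+e_ν)²` (`g` even). -/
theorem bub_half_half (g : Pt → ℝ) (hg : ∀ w, g (-w) = g w) (μ ν : Fin 4) (v : Pt) (L k : ℕ) :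
    bub (fun _ _ => g) (fun _ _ => g) (halfStn μ (1 : Matrix Unit Unit ℝ)) (halfStn ν (1 : Matrix Unit Unit ℝ)) L k (v + unitVec μ)
      = g v * g (v + unitVec μ + unitVec ν) - g (v + unitVec ν) * g (v + unitVec μ + unitVec ν) - g v * g (v + unitVec ν)
        + g (v + unitVec ν) * g (v + unitVec ν) := by
  have e1 : unitVec μ - 0 - (v + unitVec μ) = -v := by abel
  have e2 : v + unitVec μ + (unitVec ν - 0) = v + unitVec μ + unitVec ν := by rw [sub_zero]
  have e3 : unitVec μ - unitVec ν - (v + unitVec μ) = -(v + unitVec ν) := by abel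
  have e4 : v + unitVec μ + (unitVec ν - unitVec μ) = v + unitVec ν := by abel
  have t1 : ((1 : Matrix Unit Unit ℝ) * 1).trace = 1 := trace_one_unit
  have t2 : ((1 : Matrix Unit Unit ℝ) * -1).trace = -1 := by rw [Matrix.mul_neg, Matrix.trace_neg, t1]
  have t3 : ((-1 : Matrix Unit Unit ℝ) * 1).trace = -1 := by rw [Matrix.neg_mul, Matrix.trace_neg, t1]
  have t4 : ((-1 : Matrix Unit Unit ℝ) * -1).trace = 1 := by rw [Matrix.neg_mul, Matrix.mul_neg, neg_neg, t1]
  simp only [bub, bubRow, term, halfStn, Pi.add_apply, add_zero, e1, e2, e3, e4, t1, t2, t3, t4, hg]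
  ring

/-- [folklore] **THE HALF × HALF GHOST BUBBLE OVER A FROZEN EVEN LEG IS an3's «3+3» TABLE** (audit B4): `g` even, `B x y a b = δ_{ab}·g(y − x)` on the ghost
fibre `Unit`, first half word at the base site `u`, second at `u + (v + e_μ)`:
`bubble B (xhSt μ u) (xhSt ν (u + (v + e_μ))) = −(g(v + e_ν) − g v)·(g(v + e_ν + e_μ) − g(v + e_ν))` (= `−F_{e_ν}g(v)·F_{e_μ}g(v + e_ν)`). -/
theorem bubble_xhSt_xhSt_frozen (g : Pt → ℝ) (hg : ∀ w, g (-w) = g w) {B : MKer 4 Unit}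
    (hB : ∀ x y a b, B x y a b = if a = b then g (y - x) else 0) (μ ν : Fin 4) (u v : Pt) :
    bubble B (xhSt μ u) (xhSt ν (u + (v + unitVec μ)))
      = -((g (v + unitVec ν) - g v) * (g (v + unitVec ν + unitVec μ) - g (v + unitVec ν))) := by
  rw [xhSt_eq_realK, xhSt_eq_realK, bubble_realK_realK g hB _ _ u (v + unitVec μ) 0 0, bub_half_half g hg]
  have e : v + unitVec ν + unitVec μ = v + unitVec μ + unitVec ν := by abel
  rw [e]; ring

end

end Summit.QuantumFields.BalabanUV.Beta.D1BFx.GhostHalfRealised
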